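import Summits.QuantumFields.YangMills.Theorems.FiniteRankMirrorDefectPeelingPrep
import Summits.QuantumFields.YangMills.Theorems.BalabanLadderNTMarkovMirrorResponseMomentsPackage
import Summits.QuantumFields.YangMills.Theorems.BalabanLadderNTConjugateResponse
import HarnessLib

/-!
# Crux `NT` (stmt-QuantumFields-19353) clause (i): the Markov–mirror package {MF, RM₁} WITHOUT cube bookkeeping

Helper file (`--supports stmt-QuantumFields-19353`; fleet lead prover of crux `NT`, unit `ym-spine-19353-p1`, g22).  The clause-(i)
packages of the Markov–mirror series (`…NTMarkovMirrorResponseMomentsPackage.nt_of_bareFloor_l2_responseMoments`, the UVSeamRec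
CHECK-LEMMAs `…FloorsEngineOfResponseMoments`) ask their supplier for a positive-time cube family `(c β, b β)` with five bookkeeping
clauses (times `≥ 1`, physical size, femto side, support at depth `≥ 2`, thickened support at depth `≥ κ/aβ`) and state the bare
mirror floor (MF) on cube-carried smearings.  With the constructor `FiniteRankMirrorDefectPeelingPrep.exists_posTimeCubeFamily` all of
this is automatic for ONE test function `v` supported in `{y₀ > 0} ∩ B(0, ℓ)`, and (MF) may be stated in the route form
`X ≤ E_T[(Ṽ_box∘Θ₀)·Ṽ_box] − E_T[Ṽ_box]²` (box smearing, as in `FiniteRankMirror.MirrorDefectVanishes` / `StaticSourceWitness`):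

* `boxSmear_eq_cubeSmear` — the box smearing is the cube smearing when the lattice support sits in the cube;
* `cubePackage_of_boxFloor` — {`v ⊆ {y₀>0} ∩ B(0,ℓ)`, box-form (MF) at level `X` on the tori `Λ₅ ≤ aβ·L`} ⇒ the cube-family package of the
  series with femto side `b_β·aβ ≤ 5ℓ`, thickening depth `κ = δ/2` (`δ` the time floor of `v`), and (MF) in cube/product form;
* `lowerBounds_fst_of_boxBareFloor_responseMoments` — clause (i) of `LowerBounds G r a` from (RM₁) at the unit `a` (range `ℓ₁`) and ONE
  `v ⊆ {y₀>0} ∩ B(0, ℓ₁/5)` with a box-form bare mirror floor `9ε/4`;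
* `nt_of_boxBareFloor_responseMoments` — `Theses.BalabanLadder.NT` BY NAME from that package plus any clause-(ii) supplier.

HONEST FRAMING: bookkeeping only; (RM₁) is an OPEN RG statement (E0′-K with background, item 23837 / the spine's (RM)), (MF) and clause
(ii) are crux `NT`'s open mathematics (barrier `PerturbativeInvisibility`); NT NOT proved; YM mass gap NOT proved; not Clay.
-/

set_option autoImplicit false

noncomputable section

open scoped SchwartzMap
open MeasureTheory Filter Topology
open Literature.MathematicalPhysics.QuantumFieldTheory Literature.MathematicalPhysics.QuantumLattice
open Literature.Probability.LatticeModels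
open Summit.QuantumFields.YangMills.Cruxes.OSLegsFromFemtoAndGap.DlrCollarTransfer
open Summit.QuantumFields.YangMills.Cruxes.OSLegsFromFemtoAndGap.DlrCollarTransfer.StubLower (mem_cubeSites_iff)
open Summit.QuantumFields.YangMills.Cruxes.UVSeamRec.UnitTransfer (exists_time_floor_and_radius)
open Summit.QuantumFields.YangMills.Cruxes.NT.MarkovMirror (lowerBounds_fst_of_bareFloor_l2_responseMoments)

namespace Summit.QuantumFields.YangMills.Cruxes.FiniteRankMirrorDefectPeeling

section Box

variable (G : Type) [Group G] [TopologicalSpace G] [IsTopologicalGroup G] [CompactSpace G]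
  [MeasurableSpace G] [BorelSpace G] (r : LatticeRep G)

omit [MeasurableSpace G] [BorelSpace G] in
/-- The box smearing `∑_{y ∈ box 4 L} v(s·y) dens_y` is the cube smearing `∑_{y ∈ Q} v(s·y) dens_y` as soon as the lattice support of
`v(s·)` sits in the cube `Q ⊆ box 4 L`. [folklore] -/
theorem boxSmear_eq_cubeSmear [MeasurableSpace G] [BorelSpace G] (L : ℕ) (s : ℝ) (v : EuclideanSpace ℝ (Fin 4) → ℝ)
    (c : Fin 4 → ℤ) (b : ℕ) (hsub : cubeSites c b ⊆ box 4 L)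
    (hsupp : ∀ y : Fin 4 → ℤ, v (s • siteToE y) ≠ 0 → y ∈ cubeSites c b) (U : LGConfig 4 G) :
    ∑ y ∈ box 4 L, v (s • siteToE y) * dens G r y U = ∑ y ∈ cubeSites c b, v (s • siteToE y) * dens G r y U :=
  (Finset.sum_subset hsub fun y _ hy => by
    have : v (s • siteToE y) = 0 := by by_contra h; exact hy (hsupp y h)
    rw [this, zero_mul]).symm

omit [Group G] [TopologicalSpace G] [IsTopologicalGroup G] [CompactSpace G] [MeasurableSpace G] [BorelSpace G] in
/-- A cube of physical size `(|c j| + b + 3)·s ≤ Λ₅` has its sites in `box 4 L` on every torus `Λ₅ ≤ s·L`. [folklore] -/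
theorem cubeSites_subset_box_of_geom {s Λ₅ : ℝ} (hs : 0 < s) {c : Fin 4 → ℤ} {b L : ℕ}
    (hsize : ∀ j : Fin 4, (|((c j : ℤ) : ℝ)| + (b : ℝ) + 3) * s ≤ Λ₅) (hL : Λ₅ ≤ s * L) : cubeSites c b ⊆ box 4 L := by
  intro y hy
  rw [mem_box]
  intro j
  have hfit : |((c j : ℤ) : ℝ)| + (b : ℝ) + 3 ≤ (L : ℝ) := le_of_mul_le_mul_right (by nlinarith [hsize j, hL]) hs
  rw [Int.cast_abs.symm] at hfit
  have hfitZ : |c j| + (b : ℤ) + 3 ≤ (L : ℤ) := by exact_mod_cast hfit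
  have h := (mem_cubeSites_iff _ _ _).1 hy j
  have h1 := le_abs_self (c j)
  have h2 := neg_abs_le (c j)
  constructor <;> linarith [h.1, h.2]

/-- **The cube-family package from a box-form floor.**  A unit map `a > 0` with `a → 0`; ONE test function `v` with
`tsupport v ⊆ {y₀ > 0} ∩ B(0, ℓ)` (`ℓ > 0`); a level `X` with the BOX-FORM mirror bound `X ≤ E_T[(Ṽ_box∘Θ₀)·Ṽ_box] − E_T[Ṽ_box]²` for
`β ≥ β₅` on every torus `Λ₅ ≤ aβ·L`.  Then there are `κ > 0`, thresholds `β₅', Λ₅'` and a positive-time cube family `Q_β = (c β, b β)` with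
all the bookkeeping clauses of the Markov–mirror series (times `≥ 1`, physical size `≤ Λ₅'`, femto side `b_β·aβ ≤ 5ℓ`, support at depth
`≥ 2`, thickened support at depth `≥ κ/aβ`) and the same bound `X` in CUBE/PRODUCT form on the tori `Λ₅' ≤ aβ·L`
(`exists_posTimeCubeFamily` with the time floor of `v`; box = cube smearing; reflection invariance of Wilson's torus measure). [folklore] -/
theorem cubePackage_of_boxFloor (a : ℝ → ℝ) (ha₀ : ∀ β, 0 < a β) (ha : Tendsto a atTop (𝓝 0))
    (v : 𝓢(EuclideanSpace ℝ (Fin 4), ℝ)) {ℓ : ℝ} (hℓ : 0 < ℓ)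
    (hv0 : tsupport (v : EuclideanSpace ℝ (Fin 4) → ℝ) ⊆ {y | 0 < y 0})
    (hvB : tsupport (v : EuclideanSpace ℝ (Fin 4) → ℝ) ⊆ Metric.closedBall 0 ℓ) {X β₅ Λ₅ : ℝ}
    (hMF : ∀ β, β₅ ≤ β → ∀ L : ℕ, Λ₅ ≤ a β * L →
      X ≤ torusE G r β L (fun V => (∑ y ∈ box 4 L, v (a β • siteToE y) * dens G r y (cfgReflect V)) *
          ∑ y ∈ box 4 L, v (a β • siteToE y) * dens G r y V) -
        torusE G r β L (fun V => ∑ y ∈ box 4 L, v (a β • siteToE y) * dens G r y V) ^ 2) :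
    ∃ (κ β₆ Λ₆ : ℝ) (c : ℝ → (Fin 4 → ℤ)) (b : ℝ → ℕ),
      HasCompactSupport (v : EuclideanSpace ℝ (Fin 4) → ℝ) ∧ 0 < κ ∧
      (∀ β, β₆ ≤ β → 1 ≤ c β 0 ∧ ∀ j : Fin 4, (|((c β j : ℤ) : ℝ)| + (b β : ℝ) + 3) * a β ≤ Λ₆) ∧
      (∀ β, β₆ ≤ β → (b β : ℝ) * a β ≤ 5 * ℓ) ∧
      (∀ β, β₆ ≤ β → ∀ x : Fin 4 → ℤ, v (a β • siteToE x) ≠ 0 →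
        x ∈ cubeSites (c β) (b β) ∧ 2 ≤ depth (c β) (b β) x) ∧
      (∀ β, β₆ ≤ β → ∀ x : Fin 4 → ℤ,
        (v (a β • siteToE x) ≠ 0 ∨ v (a β • siteToE (x + Pi.single 0 1)) ≠ 0) →
          x ∈ cubeSites (c β) (b β) ∧ κ / a β ≤ (depth (c β) (b β) x : ℝ)) ∧
      (∀ β, β₆ ≤ β → ∀ L : ℕ, Λ₆ ≤ a β * L →
        X ≤ torusE G r β L (fun V =>
            (∑ y ∈ cubeSites (c β) (b β), v (a β • siteToE y) * dens G r y (cfgReflect V)) *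
              ∑ y ∈ cubeSites (c β) (b β), v (a β • siteToE y) * dens G r y V) -
          torusE G r β L (fun V => ∑ y ∈ cubeSites (c β) (b β), v (a β • siteToE y) * dens G r y (cfgReflect V)) *
            torusE G r β L (fun V => ∑ y ∈ cubeSites (c β) (b β), v (a β • siteToE y) * dens G r y V)) := by
  -- compact support, time floor
  have hvK : HasCompactSupport (v : EuclideanSpace ℝ (Fin 4) → ℝ) :=
    HasCompactSupport.of_support_subset_isCompact (isCompact_closedBall 0 ℓ) ((subset_tsupport _).trans hvB)
  obtain ⟨δ₀, M₀, hδ₀, -, hvT₀⟩ := exists_time_floor_and_radius hvK hv0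
  have hvBall : ∀ z, v z ≠ 0 → ‖z‖ ≤ ℓ := fun z hz => by
    have := hvB (subset_tsupport _ hz)
    rwa [Metric.mem_closedBall, dist_zero_right] at this
  set δ : ℝ := min δ₀ ℓ with hδ
  have hδpos : 0 < δ := lt_min hδ₀ hℓ
  have hδℓ : δ ≤ ℓ := min_le_right _ _
  have hvT : ∀ z, v z ≠ 0 → δ ≤ z 0 := fun z hz => (min_le_left _ _).trans (hvT₀ z hz).1
  obtain ⟨β₇, c, b, hadm, hgeom, hfem, hsupp, hthick⟩ :=
    exists_posTimeCubeFamily a ha₀ ha v hℓ hδpos hvBall hvT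
  refine ⟨δ / 2, max β₅ β₇, max Λ₅ (3 * (ℓ + δ / 2) + 14), c, b, hvK, by positivity,
    fun β hβ => ⟨(hgeom β (le_trans (le_max_right _ _) hβ)).1, fun j =>
      ((hgeom β (le_trans (le_max_right _ _) hβ)).2 j).trans (le_max_right _ _)⟩,
    fun β hβ => ?_, fun β hβ => hsupp β (le_trans (le_max_right _ _) hβ),
    fun β hβ => hthick β (le_trans (le_max_right _ _) hβ), fun β hβ L hL => ?_⟩
  · -- femto side `≤ 5ℓ`
    have h1 := hfem β (le_trans (le_max_right _ _) hβ)
    have h2 := (hadm β (le_trans (le_max_right _ _) hβ)).2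
    nlinarith
  · -- the floor in cube/product form
    have hβ₅ : β₅ ≤ β := le_trans (le_max_left _ _) hβ
    have hβ₇ : β₇ ≤ β := le_trans (le_max_right _ _) hβ
    have hL₅ : Λ₅ ≤ a β * L := le_trans (le_max_left _ _) hL
    have hLg : 3 * (ℓ + δ / 2) + 14 ≤ a β * L := le_trans (le_max_right _ _) hL
    have hsub : cubeSites (c β) (b β) ⊆ box 4 L := cubeSites_subset_box_of_geom (ha₀ β) (hgeom β hβ₇).2 hLg
    have hbox : ∀ U : LGConfig 4 G, ∑ y ∈ box 4 L, v (a β • siteToE y) * dens G r y U =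
        ∑ y ∈ cubeSites (c β) (b β), v (a β • siteToE y) * dens G r y U :=
      boxSmear_eq_cubeSmear G r L (a β) v (c β) (b β) hsub fun y hy => (hsupp β hβ₇ y hy).1
    have h := hMF β hβ₅ L hL₅
    simp only [hbox] at h
    rw [NT.ConjugateResponse.torusE_comp_cfgReflect G r β L
      (fun V => ∑ y ∈ cubeSites (c β) (b β), v (a β • siteToE y) * dens G r y V), ← sq]
    exact h

/-- **Clause (i) of `LowerBounds G r a` from (RM₁) and ONE femto-localised bare mirror floor in box form — no cube bookkeeping.**
A unit map `a > 0` with `a → 0`; the singleton response-moment law (RM₁) at the unit `a` itself (reference values `p`, `C₁ > 0`, `B`,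
`β₁`, range `ℓ₁ > 0`); ONE test function `v` with `tsupport v ⊆ {y₀ > 0} ∩ B(0, ℓ₁/5)` carrying the bare mirror floor
`9ε/4 ≤ E_T[(Ṽ_box∘Θ₀)·Ṽ_box] − E_T[Ṽ_box]²` (`ε > 0`) for `β ≥ β₅` on every torus `Λ₅ ≤ aβ·L`.  Then clause (i) of `LowerBounds G r a`
holds (`cubePackage_of_boxFloor` ⊕ `MarkovMirror.lowerBounds_fst_of_bareFloor_l2_responseMoments`). [folklore] -/
theorem lowerBounds_fst_of_boxBareFloor_responseMoments (a : ℝ → ℝ) (ha₀ : ∀ β, 0 < a β) (ha : Tendsto a atTop (𝓝 0))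
    {C₁ B β₁ ℓ₁ : ℝ} (hC₁ : 0 < C₁) (hℓ₁ : 0 < ℓ₁) (p : Fin 4 × Fin 4 → ℝ → ℝ)
    (hRM : ∀ β : ℝ, β₁ ≤ β → ∀ (L : ℕ) (q : Fin 4 × Fin 4) (x : Fin 4 → ℤ) (R : ℕ), q.1 < q.2 → 1 ≤ R →
      (R : ℝ) * a β ≤ ℓ₁ → 4 * R + 8 ≤ L →
      torusE G r β L (fun U => Real.exp ((R : ℝ) ^ 4 / C₁ *
        |kerE G r β (fun k => x k - (R + 1)) (2 * R + 3) U (plane G r q x) - p q β|)) ≤ Real.exp B)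
    (v : 𝓢(EuclideanSpace ℝ (Fin 4), ℝ)) (hv0 : tsupport (v : EuclideanSpace ℝ (Fin 4) → ℝ) ⊆ {y | 0 < y 0})
    (hvB : tsupport (v : EuclideanSpace ℝ (Fin 4) → ℝ) ⊆ Metric.closedBall 0 (ℓ₁ / 5)) {ε β₅ Λ₅ : ℝ} (hε : 0 < ε)
    (hMF : ∀ β, β₅ ≤ β → ∀ L : ℕ, Λ₅ ≤ a β * L →
      9 * ε / 4 ≤ torusE G r β L (fun V => (∑ y ∈ box 4 L, v (a β • siteToE y) * dens G r y (cfgReflect V)) *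
          ∑ y ∈ box 4 L, v (a β • siteToE y) * dens G r y V) -
        torusE G r β L (fun V => ∑ y ∈ box 4 L, v (a β • siteToE y) * dens G r y V) ^ 2) :
    ∃ (v : 𝓢(EuclideanSpace ℝ (Fin 4), ℝ)) (ε β₅ Λ₅ : ℝ),
      tsupport (v : EuclideanSpace ℝ (Fin 4) → ℝ) ⊆ {y : EuclideanSpace ℝ (Fin 4) | 0 < y 0} ∧ 0 < ε ∧
      ∀ β : ℝ, β₅ ≤ β → ∀ L : ℕ, Λ₅ ≤ a β * L → ε ≤ Q2 G r β L (a β) (thetaTest 4 v) v := by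
  obtain ⟨κ, β₆, Λ₆, c, b, hvK, hκ, hgeom, hfem, hsupp, hthick, hMFc⟩ :=
    cubePackage_of_boxFloor G r a ha₀ ha v (by positivity : (0 : ℝ) < ℓ₁ / 5) hv0 hvB hMF
  exact lowerBounds_fst_of_bareFloor_l2_responseMoments G r a a ha₀ ha v hvK hv0 hε hκ hC₁ hℓ₁ p c b hgeom
    (fun β hβ => by linarith [hfem β hβ]) hsupp hthick hRM hMFc

end Box

end Summit.QuantumFields.YangMills.Cruxes.FiniteRankMirrorDefectPeeling

/-- **`NT` BY NAME from {box-form MF on ONE femto-localised bump, RM₁ at the same unit} and any clause-(ii) supplier** — the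
Markov–mirror clause-(i) package of `MarkovMirror.nt_of_bareFloor_l2_responseMoments` with the cube family, the femto-commensurability
clause and the thickening depth REMOVED from the hypotheses (constructed by `FiniteRankMirrorDefectPeelingPrep.exists_posTimeCubeFamily`).
Every compact simple `G`, Borel σ-algebra.  No NT / summit statement is proved unconditionally. [folklore] -/
theorem Summit.QuantumFields.YangMills.Theorems.nt_of_boxBareFloor_responseMoments
    (h : ∀ (G : Type) [Group G] [TopologicalSpace G] [IsTopologicalGroup G] [CompactSpace G],
      Literature.MathematicalPhysics.QuantumFieldTheory.IsCompactSimpleLieGroup G →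
      letI : MeasurableSpace G := borel G; haveI : BorelSpace G := ⟨rfl⟩;
      ∃ (r : Literature.MathematicalPhysics.QuantumFieldTheory.LatticeRep G) (a : ℝ → ℝ),
        (∀ β, 0 < a β) ∧ Filter.Tendsto a Filter.atTop (nhds 0) ∧
        (∃ (C₁ B β₁ ℓ₁ : ℝ) (p : Fin 4 × Fin 4 → ℝ → ℝ), 0 < C₁ ∧ 0 < ℓ₁ ∧
          (∀ β : ℝ, β₁ ≤ β → ∀ (L : ℕ) (q : Fin 4 × Fin 4) (x : Fin 4 → ℤ) (R : ℕ), q.1 < q.2 → 1 ≤ R →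
            (R : ℝ) * a β ≤ ℓ₁ → 4 * R + 8 ≤ L →
            Summit.QuantumFields.YangMills.Cruxes.OSLegsFromFemtoAndGap.DlrCollarTransfer.torusE G r β L (fun U =>
              Real.exp ((R : ℝ) ^ 4 / C₁ *
                |Summit.QuantumFields.YangMills.Cruxes.OSLegsFromFemtoAndGap.DlrCollarTransfer.kerE G r β
                    (fun k => x k - (R + 1)) (2 * R + 3) U
                    (Summit.QuantumFields.YangMills.Cruxes.OSLegsFromFemtoAndGap.DlrCollarTransfer.plane G r q x) - p q β|)) ≤
              Real.exp B) ∧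
          (∃ (v : SchwartzMap (EuclideanSpace ℝ (Fin 4)) ℝ) (ε β₅ Λ₅ : ℝ),
            tsupport (v : EuclideanSpace ℝ (Fin 4) → ℝ) ⊆ {y | 0 < y 0} ∧
            tsupport (v : EuclideanSpace ℝ (Fin 4) → ℝ) ⊆ Metric.closedBall 0 (ℓ₁ / 5) ∧ 0 < ε ∧
            ∀ β : ℝ, β₅ ≤ β → ∀ L : ℕ, Λ₅ ≤ a β * L →
              9 * ε / 4 ≤ Summit.QuantumFields.YangMills.Cruxes.OSLegsFromFemtoAndGap.DlrCollarTransfer.torusE G r β L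
                  (fun V => (∑ y ∈ Literature.Probability.LatticeModels.box 4 L,
                      v (a β • Literature.MathematicalPhysics.QuantumLattice.siteToE y) *
                        Summit.QuantumFields.YangMills.Cruxes.OSLegsFromFemtoAndGap.DlrCollarTransfer.dens G r y
                          (Literature.MathematicalPhysics.QuantumFieldTheory.cfgReflect V)) *
                    ∑ y ∈ Literature.Probability.LatticeModels.box 4 L,
                      v (a β • Literature.MathematicalPhysics.QuantumLattice.siteToE y) *
                        Summit.QuantumFields.YangMills.Cruxes.OSLegsFromFemtoAndGap.DlrCollarTransfer.dens G r y V) -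
                Summit.QuantumFields.YangMills.Cruxes.OSLegsFromFemtoAndGap.DlrCollarTransfer.torusE G r β L
                  (fun V => ∑ y ∈ Literature.Probability.LatticeModels.box 4 L,
                    v (a β • Literature.MathematicalPhysics.QuantumLattice.siteToE y) *
                      Summit.QuantumFields.YangMills.Cruxes.OSLegsFromFemtoAndGap.DlrCollarTransfer.dens G r y V) ^ 2)) ∧
        (∃ (f g h : SchwartzMap (EuclideanSpace ℝ (Fin 4)) ℝ) (ε β₅ Λ₅ : ℝ), Disjoint (tsupport f) (tsupport g) ∧
          Disjoint (tsupport g) (tsupport h) ∧ Disjoint (tsupport f) (tsupport h) ∧ 0 < ε ∧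
          ∀ β : ℝ, β₅ ≤ β → ∀ L : ℕ, Λ₅ ≤ a β * L →
            ε ≤ |Summit.QuantumFields.YangMills.Cruxes.OSLegsFromFemtoAndGap.DlrCollarTransfer.Q3 G r β L (a β) f g h|)) :
    Summit.QuantumFields.YangMills.Theses.BalabanLadder.NT := by
  intro G _ _ _ _ hG
  letI : MeasurableSpace G := borel G
  haveI : BorelSpace G := ⟨rfl⟩
  obtain ⟨r, a, ha₀, ha, ⟨C₁, B, β₁, ℓ₁, p, hC₁, hℓ₁, hRM, v, ε, β₅, Λ₅, hv0, hvB, hε, hMF⟩, h3⟩ := h G hG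
  exact ⟨r, a, ha₀, ha,
    Summit.QuantumFields.YangMills.Cruxes.FiniteRankMirrorDefectPeeling.lowerBounds_fst_of_boxBareFloor_responseMoments G r a ha₀ ha
      hC₁ hℓ₁ p hRM v hv0 hvB hε hMF, h3⟩

end
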